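import Summits.Ventures.Crystal3D.Bulk.HullFaceCone
import Summits.Ventures.Crystal3D.Bulk.GapRattlerCount
import Summits.Ventures.Crystal3D.Bulk.SphSegmentCap
import Summits.Ventures.Crystal3D.Bulk.HexPerimeterDefs
import HarnessLib

/-!
# Per-side rattler rows and insideness along a face walk of a census configuration; perimeter
# of a reversed walk — census-side bricks of (d3) «at most one rattler per p-hexagon»

HONEST FRAMING. Part of the venture `Summits/Ventures/Crystal3D` (cell `pub-crystal3d`, phase 2;
seat typer-bulk-2). Kernel lemmas about every configuration satisfying `CensusRows c`
(`Bulk/GapCensusRows.lean`); nothing is claimed about GAP(1.26). They are the census-side inputs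
of the (d3) assembly `Bulk/GapRattlerInjective.lean` (which adds the main metric theorem of
`Bulk/HexagonTwoRattlers.lean`); plan `HOME/lean/hexper/README.md`, paper proof
`phase2/theory1/HEX-PERIMETER.md`.

* `polyPerim_reverse` — the reversed periodic walk `i ↦ v (n − 1 − i % n)` has the same
  perimeter `polyPerim` (`Bulk/HexPerimeterDefs.lean`);
* `CensusRows.orient3_oface_nonneg_of_inCornerFan` — a direction in the corner fan of the face
  of a dart `q` (p3's `InCornerFan`) is inside every side of the face walk
  (`HullRotSys.inFaceCone_of_cover`, `Bulk/HullFaceCone.lean`);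
* `CensusRows.inner_rattler_side_le` — the per-side rattler rows
  `⟪ĉ_j, a v_t + b v_{t+1}⟫ ≤ √(83/200) ‖a v_t + b v_{t+1}‖` (`a, b ≥ 0`) along any face walk, from
  the vertex rows (`≤ 1/2` at an active shell ball, `≤ D/2` at the hole) and the side levels
  (`Bulk/SphSegmentCap.lean`, `κ = D/2 ≤ 63/100`).
-/

noncomputable section

namespace Summit.Ventures.Crystal3D

open Literature.Geometry.DiscreteGeometry Finset Equiv HullRotSys Function Real InnerProductGeometry
open scoped InnerProductSpace RealInnerProductSpace

/-! ## Perimeter of the reversed walk -/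

/-- **The reversed walk has the same perimeter.** -/
theorem polyPerim_reverse (v : ℕ → EuclideanSpace ℝ (Fin 3)) {n : ℕ} (hn : 1 ≤ n)
    (hper : ∀ i, v (i + n) = v i) :
    polyPerim (fun i => v (n - 1 - i % n)) n = polyPerim v n := by
  obtain ⟨m, rfl⟩ : ∃ m, n = m + 1 := ⟨n - 1, by omega⟩
  unfold polyPerim
  rw [Finset.sum_range_succ, Finset.sum_range_succ]
  congr 1
  · rw [← Finset.sum_range_reflect (fun s => angle (v s) (v (s + 1))) m]
    refine Finset.sum_congr rfl fun j hj => ?_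
    rw [mem_range] at hj
    dsimp only
    rw [Nat.mod_eq_of_lt (by omega : j < m + 1), Nat.mod_eq_of_lt (by omega : j + 1 < m + 1),
      angle_comm, show m + 1 - 1 - (j + 1) = m - 1 - j by omega,
      show m + 1 - 1 - j = m - 1 - j + 1 by omega]
  · dsimp only
    rw [Nat.mod_eq_of_lt (by omega : m < m + 1), Nat.mod_self, Nat.sub_zero,
      show m + 1 - 1 - m = 0 by omega, angle_comm, ← hper 0, zero_add, show m + 1 - 1 = m by omega]

/-! ## Census-side rows along a face walk -/

variable {c : Fin 14 → EuclideanSpace ℝ (Fin 3)}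

/-- **A direction in the corner fan of a face is inside every side of the face walk** (census
form of `HullRotSys.inFaceCone_of_cover`). -/
theorem CensusRows.orient3_oface_nonneg_of_inCornerFan (h : CensusRows c) {q : Fin 14 × Fin 14}
    (hq : q ∈ darts c) {z : EuclideanSpace ℝ (Fin 3)}
    (hfan : InCornerFan h.isGapConfig.norm_of_mem_activeDirSet
      h.zero_mem_interior_convexHull_activeDirSet (tightDartsIn c (activeDirSet c))
      ⟨dirPair c q, h.dirPair_mem_hullDarts_active q hq⟩ z) (t : ℕ) :
    0 ≤ orient3 (gapDir c ((ofaceSucc c)^[t + 1] q).1) (gapDir c ((ofaceSucc c)^[t] q).1) z := by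
  have := inFaceCone_of_cover (isClosed_tightDartsIn c _) h.cover_active h.numK_active
    (fun _ hz => h.cornerAt_tightDartsIn_lt_pi _ _ h.dirPair_mem_hullDarts_active hz)
    (mem_tightDartsIn.2 ⟨q, hq, rfl⟩) hfan t
  rwa [h.faceVertex_active_eq hq, h.faceVertex_active_eq hq] at this

/-- **The per-side rattler rows along a face walk.** For a rattler `j` (a shell ball with no tight
partner) and any side `v_t v_{t+1}` of the face walk of a dart `q`:
`⟪ĉ_j, a v_t + b v_{t+1}⟫ ≤ √(83/200) ‖a v_t + b v_{t+1}‖` for `a, b ≥ 0`. -/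
theorem CensusRows.inner_rattler_side_le (h : CensusRows c) {q : Fin 14 × Fin 14} (hq : q ∈ darts c)
    {j : Fin 14} (hj0 : j ≠ 0) (hj13 : j ≠ 13)
    (hratt : ∀ k : Fin 14, k ≠ 0 → k ≠ j → dist (c j) (c k) ≠ 1) (t : ℕ) {a b : ℝ} (ha : 0 ≤ a)
    (hb : 0 ≤ b) :
    ⟪gapDir c j, a • gapDir c ((ofaceSucc c)^[t] q).1 + b • gapDir c ((ofaceSucc c)^[t + 1] q).1⟫ ≤
      Real.sqrt (83 / 200) *
        ‖a • gapDir c ((ofaceSucc c)^[t] q).1 + b • gapDir c ((ofaceSucc c)^[t + 1] q).1‖ := by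
  have hdart : (ofaceSucc c)^[t] q ∈ darts c := h.iterate_ofaceSucc_mem_darts hq t
  obtain ⟨h1, h2, h12, hd⟩ := mem_darts.1 hdart
  rw [fst_iterate_succ]
  set i := ((ofaceSucc c)^[t] q).1 with hi
  set i' := ((ofaceSucc c)^[t] q).2 with hi'
  have hvv : ⟪gapDir c i, gapDir c i'⟫ = tightLevel c i i' := h.isGapConfig.inner_gapDir_eq h1 h2 hd
  have hn1 : ‖gapDir c i‖ = 1 := h.isGapConfig.norm_gapDir h1
  have hn2 : ‖gapDir c i'‖ = 1 := h.isGapConfig.norm_gapDir h2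
  -- the vertex rows of the rattler
  have hzv : ∀ k : Fin 14, k ≠ 0 → k ≠ 13 → (tightNbrs c k).Nonempty →
      ⟪gapDir c j, gapDir c k⟫ ≤ 1 / 2 := fun k hk0 hk13 hk =>
    h.inner_gapDir_rattler_le_half hj0 hj13 hratt hk0 hk13 hk
  have hzp : ⟪gapDir c j, gapDir c 13⟫ ≤ intruderDist c / 2 := by
    have := h.isGapConfig.inner_gapDir_le hj0 (by decide : (13 : Fin 14) ≠ 0) hj13
    rwa [tightLevel_of_right] at this
  have hact1 : (tightNbrs c i).Nonempty := ⟨_, snd_mem_tightNbrs_of_mem_darts hdart⟩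
  have hact2 : (tightNbrs c i').Nonempty := ⟨_, snd_mem_tightNbrs_of_mem_darts (swap_mem_darts hdart)⟩
  -- the hole radius
  have hκ0 : 0 ≤ intruderDist c / 2 := by linarith [h.one_lt_intruderDist]
  have hκ1 : intruderDist c / 2 ≤ 63 / 100 := by
    have := h.intruderDist_le; norm_num at this; linarith
  by_cases hi13 : i = 13
  · -- side out of the hole
    have hi'13 : i' ≠ 13 := fun h' => h12 (hi13.trans h'.symm)
    rw [hi13] at hvv hn1 ⊢
    rw [tightLevel_of_left] at hvv
    exact inner_combo_le_of_hole_edge hn1 hn2 hκ0 hκ1 hzp (hzv i' h2 hi'13 hact2) hvv ha hb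
  by_cases hi'13 : i' = 13
  · -- side into the hole
    rw [hi'13] at hvv hn2 ⊢
    rw [tightLevel_of_right, real_inner_comm] at hvv
    rw [add_comm (a • gapDir c i)]
    exact inner_combo_le_of_hole_edge hn2 hn1 hκ0 hκ1 hzp (hzv i h1 hi13 hact1) hvv hb ha
  · -- shell–shell side
    rw [tightLevel_of_ne hi13 hi'13] at hvv
    exact inner_combo_le_of_shell_edge hn1 hn2 (hzv i h1 hi13 hact1) (hzv i' h2 hi'13 hact2) hvv ha hb

end Summit.Ventures.Crystal3D

end
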